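import Summits.QuantumFields.YangMills.Theorems.BalabanUVNodesN22AtRecordOfTermStepRecursion
import Literature.MathematicalPhysics.QuantumFieldTheory.Balaban1983to89.Node00.HistoryRecursionOfRecord

/-!
# BalabanUVNodes ∕ node N22 = NE9 — THE RECURSION CURRENCY ON node00-def-W1's GENERATOR: the term-level step schemas (T1), (T2-last), (T2-old) of module J51 for the
# GENERATED tower `toClusterTower G` (and its run truncations `truncRun K (toClusterTower G)`) from ONE-STEP-MAP schemas on the generator `G : GenTower P 𝔸 M` — Lipschitz
# structure of the single map `(g_k, (E^{(j)})_{j≤k}) ↦ E^{(k+1)}(X; ·)` of [I] (2.12)–(2.13) at first and second order, on an admissibility domain of older-term families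

Cell `pub-ymgap`, HUMAN RULING D-0062 (Track A), R134 seat `pub-ymgap-dag-n22-c` (strategy s1), generation 17, module J53.  THEOREMS ONLY (no `def`, no `sorry`, standard axioms);
`--kind proof --supports stmt-QuantumFields-27366 --as helper` (K3⁸ `SpineGivenEndpointR13SepCoPHV`), COUNT-NEUTRAL.  Imports module J52 (through it J51's term-level theorems) and
node00-def-W1's `HistoryRecursionOfRecord` (`StepGen`, `GenTower`, `OlderTerms`, `olderOf`, `recTerm`, `toClusterTower`, `truncRun`, `termC_toClusterTower`, `recTerm_succ`,
`recTerm_congr_prefix`, `E_termlessTower`).  Nothing re-declared; every step is plain application.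

WHY (the analogue of module J44 for the recursion currency).  J51∕J52 display the step schemas on the TERMS of an abstract tower `S` — quantified over PAIRS OF HISTORIES `g, g′` and
majorants `D`.  On def-W1's GENERATED towers the terms ARE the iterates of ONE map per step, `recTerm G g (k+1) X φ = (G k).E (g k) (olderOf (recTerm G g) k) φ X` ([I] (2.13):
the earlier couplings enter through the older terms only, BY CONSTRUCTION), so the schemas follow from properties of that single map `(t, old) ↦ (G k).E t old φ X` of the LAST
coupling `t` and the OLDER-TERM FAMILY `old : OlderTerms P 𝔸 M k`, on an admissibility domain `Adm k` of older-term families (e.g. the (1.18)-balls) containing the generated ones: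
* (G-T1) — FIRST ORDER: for `t, t′ ∈ ]0, γ]`, admissible `old, old′` and a majorant `D` of `‖old_j − old′_j‖·e^{κd}` on the space tables of the levels `j = 1, …, k`:
  `‖(G k).E t old φ X − (G k).E t′ old′ φ X‖ ≤ e^{−κd_{k+1}(X)}(lam k·|t − t′| + Σ_{j≤k} a k j·D j)` — pub-balaban's «the step map {last coupling, old terms} ↦ new term is Lipschitz»
  (`T4HistoryLipschitzRecursion.StepLipschitz`'s docstring) as a property of the map;
* (G-T2-last) — second differences of `t ↦ (G k).E t old φ X` on `]0, γ]` at admissible `old`: `≤ lam₂ k·d²·e^{−κd}`;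
* (G-T2-old) — SECOND ORDER IN THE OLDER TERMS at fixed `t ∈ ]0, γ]`: for admissible `o₁, o₂, o₃` with first ∕ second difference profiles `D₁`, `D₂` on the tables,
  `‖E(t,o₁) − 2E(t,o₂) + E(t,o₃)‖ ≤ e^{−κd}Σ_{j≤k}(a k j·D₂ j + b k j·(D₁ j)²)` (the chain rule through the curly bracket, dag-n22-a's shape, as a property of the map);
* (Adm-run) — the generated older-term families `olderOf (recTerm G ↑g) k` of every window history are admissible ([I]'s inductive hypothesis (1.18) along the flow — a TOWER
  property, displayed separately and honestly).
THIS FILE: §1 (G-T1) + (Adm-run) ⟹ (T1) for `toClusterTower G` (`termT1_toClusterTower_of_gen`); (G-T2-last) ⟹ (T2-last) (`termT2last_toClusterTower_of_gen`: the older terms do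
not read `g_k`, `recTerm_congr_prefix`); (G-T2-old) ⟹ (T2-old) (`termT2old_toClusterTower_of_gen`).  §2 ★★ `termSecondDiffAt_box_toClusterTower_of_genStepRecursion` — the term-level
second-difference letter with table `L₂·ν^{k−i}` (J51 ★★) for the generated tower from the generator schemas.  §3 `termSecondDiffAt_box_truncRun` — any such letter with a
non-negative table passes to the run truncations `truncRun K S` (no term after the run: `E_termlessTower`); ★★ `termSecondDiffAt_box_truncRun_toClusterTower_of_genStepRecursion` —
the letter for def-W1's run towers of record `truncRun K (toClusterTower G)`, the shape module J54 feeds to J52∕J49 at the record.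

HONEST FRAMING (binding).  Count-neutral COMPOSITION; (G-T1)∕(G-T2-last)∕(G-T2-old)∕(Adm-run) are HYPOTHESIS SHAPES on def-W1's generator (cell NEW-ESTIMATE shapes, NOT PRINTED —
GAPS G-t4-U3-1∕-3; [I] prints (0.23) p. 256, (2.12)–(2.13) p. 268, the C^∞ clause p. 263 and «depends also on all preceding coupling constants» p. 298 without constants; a producer is
node N10 ∕ NODE A on def-T's generator of record); inhabited by every generator whose terms ignore `(t, old)` (A5: content = the composition's shape, conditional); NO estimate of
Bałaban's is proved or asserted; nothing of the record is constructed; `𝔸 : Type`.  N22 is NOT discharged (typed 28∕28 · discharged 5∕27 UNCHANGED); K3⁸ OPEN and NOT claimed;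
NE9 is NOT IN PRINT for d = 4; no count claim; one finite 𝕋⁴ programme at fixed ε — R4 closes the CONDITIONAL rung `BalabanLadder.UV` only; NOTHING about the continuum limit, ℝ⁴,
infinite volume, OS axioms, a mass gap or the Clay problem is proved or claimed.  References (TYPES only): [I] = Bałaban, CMP 109 (1987) (0.23)–(0.24) pp. 256–257, §1 p. 263,
(2.12)–(2.13) p. 268, §3 p. 270, §5 p. 298; [II] = CMP 116 (1988) (1.41) p. 11, (2.13)–(2.14) pp. 14–15.
-/

noncomputable section

open Set Metric
open scoped BigOperators

namespace YMDAG.N22.TermRecursion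

open Literature.MathematicalPhysics.QuantumFieldTheory.Balaban1983to89
open Literature.MathematicalPhysics.QuantumFieldTheory.Balaban1983to89.T4OutputRate (Window)
open Literature.MathematicalPhysics.QuantumFieldTheory.Balaban1983to89.Node00.Sect2 (domSys CPair)
open Literature.MathematicalPhysics.QuantumFieldTheory.Balaban1983to89.Node00.W1
open YMDAG.N22.KernelFading (update_mem_window)

variable {P : Params} {𝔸 : Type} {M : ℕ} (G : GenTower P 𝔸 M) (sp : (k : ℕ) → (domSys P M (k + 1)).Dom → Set (CPair P 𝔸))
  (Adm : (k : ℕ) → OlderTerms P 𝔸 M k → Prop)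

/-! ## §1 Generator schemas ⟹ term schemas for the generated tower `toClusterTower G` -/

/-- The generated older terms at step `k` do not read the couplings `g_k, g_{k+1}, …` (def-W1's `recTerm_congr_prefix`): updating a coordinate `i ≥ k` leaves
`olderOf (recTerm G ↑g) k` unchanged. [folklore] -/
theorem olderOf_recTerm_update_of_le (g : ℕ → ℝ) {k i : ℕ} (hki : k ≤ i) (s : ℝ) :
    olderOf (recTerm G fun n => ((Function.update g i s n : ℝ) : ℂ)) k = olderOf (recTerm G fun n => ((g n : ℝ) : ℂ)) k := by
  funext j Y ψ
  rw [olderOf_apply, olderOf_apply]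
  refine recTerm_congr_prefix G j (fun m hm => ?_) Y ψ
  have hmi : m ≠ i := by have := j.2; omega
  rw [Function.update_of_ne hmi]

open Finset in
/-- ★ **(G-T1) + (Adm-run) ⟹ (T1) for the generated tower.**  The one-step map's first-order Lipschitz schema in (last coupling, older terms) on the admissibility domain,
with the generated older-term families admissible along the window, gives module J51's term-level schema (T1) for `toClusterTower G` — `termC_toClusterTower` + `recTerm_succ`
(the level-`(k+1)` term IS the map at `(g_k, olderOf (recTerm G ↑g) k)`; the antecedent's older terms ARE the generated ones). [folklore] -/
theorem termT1_toClusterTower_of_gen {γ κ : ℝ} {lam : ℕ → ℝ} {a : ℕ → ℕ → ℝ}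
    (hAdm : ∀ g ∈ Window γ, ∀ k, Adm k (olderOf (recTerm G fun n => ((g n : ℝ) : ℂ)) k))
    (hG1 : ∀ (k : ℕ), ∀ t ∈ Ioc (0 : ℝ) γ, ∀ t' ∈ Ioc (0 : ℝ) γ, ∀ (old old' : OlderTerms P 𝔸 M k), Adm k old → Adm k old' → ∀ (D : ℕ → ℝ),
      (∀ (k' : ℕ) (hk' : k' < k) (Y : (domSys P M (k' + 1)).Dom), ∀ φ' ∈ sp k' Y,
        ‖old ⟨k' + 1, Nat.succ_lt_succ hk'⟩ Y φ' - old' ⟨k' + 1, Nat.succ_lt_succ hk'⟩ Y φ'‖ ≤ Real.exp (-(κ * (domSys P M (k' + 1)).dj Y)) * D (k' + 1)) →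
      ∀ (X : (domSys P M (k + 1)).Dom), ∀ φ ∈ sp k X,
        ‖(G k).E ((t : ℝ) : ℂ) old φ X - (G k).E ((t' : ℝ) : ℂ) old' φ X‖ ≤
          Real.exp (-(κ * (domSys P M (k + 1)).dj X)) * (lam k * |t - t'| + ∑ j ∈ range (k + 1), a k j * D j)) :
    ∀ g ∈ Window γ, ∀ g' ∈ Window γ, ∀ (D : ℕ → ℝ) (k : ℕ),
      (∀ k' < k, ∀ (X' : (domSys P M (k' + 1)).Dom), ∀ φ' ∈ sp k' X',
        ‖termC (toClusterTower G) (k' + 1) X' g φ' - termC (toClusterTower G) (k' + 1) X' g' φ'‖ ≤ Real.exp (-(κ * (domSys P M (k' + 1)).dj X')) * D (k' + 1)) →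
      ∀ (X : (domSys P M (k + 1)).Dom), ∀ φ ∈ sp k X,
        ‖termC (toClusterTower G) (k + 1) X g φ - termC (toClusterTower G) (k + 1) X g' φ‖ ≤
          Real.exp (-(κ * (domSys P M (k + 1)).dj X)) * (lam k * |g k - g' k| + ∑ j ∈ range (k + 1), a k j * D j) := by
  intro g hg g' hg' D k hold X φ hφ
  rw [termC_toClusterTower, termC_toClusterTower, recTerm_succ, recTerm_succ]
  refine hG1 k (g k) (hg k) (g' k) (hg' k) _ _ (hAdm g hg k) (hAdm g' hg' k) D (fun k' hk' Y φ' hφ' => ?_) X φ hφ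
  rw [olderOf_apply, olderOf_apply, ← termC_toClusterTower, ← termC_toClusterTower]
  exact hold k' hk' Y φ' hφ'

/-- ★ **(G-T2-last) + (Adm-run) ⟹ (T2-last) for the generated tower.**  Second differences of the one-step map in its LAST coupling at admissible older terms give J51's (T2-last)
for `toClusterTower G` — the three updated histories `g∣g_k:=t±d, t` generate the SAME older terms (`olderOf_recTerm_update_of_le`). [folklore] -/
theorem termT2last_toClusterTower_of_gen {γ κ : ℝ} {lam₂ : ℕ → ℝ}
    (hAdm : ∀ g ∈ Window γ, ∀ k, Adm k (olderOf (recTerm G fun n => ((g n : ℝ) : ℂ)) k))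
    (hG2last : ∀ (k : ℕ) (old : OlderTerms P 𝔸 M k), Adm k old → ∀ (t d : ℝ), 0 < d → t - d ∈ Ioc (0 : ℝ) γ → t + d ∈ Ioc (0 : ℝ) γ →
      ∀ (X : (domSys P M (k + 1)).Dom), ∀ φ ∈ sp k X,
        ‖(G k).E ((t + d : ℝ) : ℂ) old φ X - 2 * (G k).E ((t : ℝ) : ℂ) old φ X + (G k).E ((t - d : ℝ) : ℂ) old φ X‖ ≤
          Real.exp (-(κ * (domSys P M (k + 1)).dj X)) * (lam₂ k * d ^ 2)) :
    ∀ g ∈ Window γ, ∀ (k : ℕ) (t d : ℝ), 0 < d → t - d ∈ Ioc (0 : ℝ) γ → t + d ∈ Ioc (0 : ℝ) γ →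
      ∀ (X : (domSys P M (k + 1)).Dom), ∀ φ ∈ sp k X,
        ‖termC (toClusterTower G) (k + 1) X (Function.update g k (t + d)) φ - 2 * termC (toClusterTower G) (k + 1) X (Function.update g k t) φ +
            termC (toClusterTower G) (k + 1) X (Function.update g k (t - d)) φ‖ ≤ Real.exp (-(κ * (domSys P M (k + 1)).dj X)) * (lam₂ k * d ^ 2) := by
  intro g hg k t d hd hm hp X φ hφ
  rw [termC_toClusterTower, termC_toClusterTower, termC_toClusterTower, recTerm_succ, recTerm_succ, recTerm_succ,
    olderOf_recTerm_update_of_le G g le_rfl, olderOf_recTerm_update_of_le G g le_rfl, olderOf_recTerm_update_of_le G g le_rfl,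
    Function.update_self, Function.update_self, Function.update_self]
  exact hG2last k _ (hAdm g hg k) t d hd hm hp X φ hφ

open Finset in
/-- ★ **(G-T2-old) + (Adm-run) ⟹ (T2-old) for the generated tower.**  The one-step map's SECOND-ORDER schema in the older terms at fixed last coupling (linear channel `a` on
second differences, variance channel `b` on squares of first differences of three admissible older-term families) gives J51's (T2-old) for `toClusterTower G` — at an older
coordinate `i < k` the last coupling `g_k` is untouched and the three older-term families are the generated ones of `g∣g_i:=t+d, t, t−d`. [folklore] -/
theorem termT2old_toClusterTower_of_gen {γ κ : ℝ} {a b : ℕ → ℕ → ℝ}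
    (hAdm : ∀ g ∈ Window γ, ∀ k, Adm k (olderOf (recTerm G fun n => ((g n : ℝ) : ℂ)) k))
    (hG2old : ∀ (k : ℕ), ∀ t ∈ Ioc (0 : ℝ) γ, ∀ (o₁ o₂ o₃ : OlderTerms P 𝔸 M k), Adm k o₁ → Adm k o₂ → Adm k o₃ → ∀ (D₁ D₂ : ℕ → ℝ),
      (∀ (k' : ℕ) (hk' : k' < k) (Y : (domSys P M (k' + 1)).Dom), ∀ φ' ∈ sp k' Y,
        ‖o₁ ⟨k' + 1, Nat.succ_lt_succ hk'⟩ Y φ' - o₂ ⟨k' + 1, Nat.succ_lt_succ hk'⟩ Y φ'‖ ≤ Real.exp (-(κ * (domSys P M (k' + 1)).dj Y)) * D₁ (k' + 1) ∧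
        ‖o₂ ⟨k' + 1, Nat.succ_lt_succ hk'⟩ Y φ' - o₃ ⟨k' + 1, Nat.succ_lt_succ hk'⟩ Y φ'‖ ≤ Real.exp (-(κ * (domSys P M (k' + 1)).dj Y)) * D₁ (k' + 1) ∧
        ‖o₁ ⟨k' + 1, Nat.succ_lt_succ hk'⟩ Y φ' - 2 * o₂ ⟨k' + 1, Nat.succ_lt_succ hk'⟩ Y φ' + o₃ ⟨k' + 1, Nat.succ_lt_succ hk'⟩ Y φ'‖ ≤
          Real.exp (-(κ * (domSys P M (k' + 1)).dj Y)) * D₂ (k' + 1)) →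
      ∀ (X : (domSys P M (k + 1)).Dom), ∀ φ ∈ sp k X,
        ‖(G k).E ((t : ℝ) : ℂ) o₁ φ X - 2 * (G k).E ((t : ℝ) : ℂ) o₂ φ X + (G k).E ((t : ℝ) : ℂ) o₃ φ X‖ ≤
          Real.exp (-(κ * (domSys P M (k + 1)).dj X)) * ∑ j ∈ range (k + 1), (a k j * D₂ j + b k j * D₁ j ^ 2)) :
    ∀ g ∈ Window γ, ∀ (i : ℕ) (t d : ℝ), 0 < d → t - d ∈ Ioc (0 : ℝ) γ → t + d ∈ Ioc (0 : ℝ) γ →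
      ∀ (D₁ D₂ : ℕ → ℝ) (k : ℕ), i < k →
        (∀ k' < k, ∀ (X' : (domSys P M (k' + 1)).Dom), ∀ φ' ∈ sp k' X',
          ‖termC (toClusterTower G) (k' + 1) X' (Function.update g i (t + d)) φ' - termC (toClusterTower G) (k' + 1) X' (Function.update g i t) φ'‖ ≤
              Real.exp (-(κ * (domSys P M (k' + 1)).dj X')) * D₁ (k' + 1) ∧
          ‖termC (toClusterTower G) (k' + 1) X' (Function.update g i t) φ' - termC (toClusterTower G) (k' + 1) X' (Function.update g i (t - d)) φ'‖ ≤
              Real.exp (-(κ * (domSys P M (k' + 1)).dj X')) * D₁ (k' + 1) ∧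
          ‖termC (toClusterTower G) (k' + 1) X' (Function.update g i (t + d)) φ' - 2 * termC (toClusterTower G) (k' + 1) X' (Function.update g i t) φ' +
              termC (toClusterTower G) (k' + 1) X' (Function.update g i (t - d)) φ'‖ ≤ Real.exp (-(κ * (domSys P M (k' + 1)).dj X')) * D₂ (k' + 1)) →
        ∀ (X : (domSys P M (k + 1)).Dom), ∀ φ ∈ sp k X,
          ‖termC (toClusterTower G) (k + 1) X (Function.update g i (t + d)) φ - 2 * termC (toClusterTower G) (k + 1) X (Function.update g i t) φ +
              termC (toClusterTower G) (k + 1) X (Function.update g i (t - d)) φ‖ ≤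
            Real.exp (-(κ * (domSys P M (k + 1)).dj X)) * ∑ j ∈ range (k + 1), (a k j * D₂ j + b k j * D₁ j ^ 2) := by
  intro g hg i t d hd hm hp D₁ D₂ k hik hold X φ hφ
  have ht : t ∈ Ioc (0 : ℝ) γ := ⟨by linarith [hm.1], by linarith [hp.2]⟩
  have hik' : k ≠ i := by omega
  rw [termC_toClusterTower, termC_toClusterTower, termC_toClusterTower, recTerm_succ, recTerm_succ, recTerm_succ,
    Function.update_of_ne hik', Function.update_of_ne hik', Function.update_of_ne hik']
  refine hG2old k (g k) (hg k) _ _ _ (hAdm _ (update_mem_window hg i hp) k) (hAdm _ (update_mem_window hg i ht) k) (hAdm _ (update_mem_window hg i hm) k)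
    D₁ D₂ (fun k' hk' Y φ' hφ' => ?_) X φ hφ
  rw [olderOf_apply, olderOf_apply, olderOf_apply, ← termC_toClusterTower, ← termC_toClusterTower, ← termC_toClusterTower]
  exact hold k' hk' Y φ' hφ'

/-! ## §2 ★★ The term-level second-difference letter for the generated tower from the generator schemas -/

open Finset in
/-- ★★ **THE TERM-LEVEL SECOND-DIFFERENCE LETTER WITH TABLE `L₂·ν^{k−i}` FOR THE GENERATED TOWER FROM THE ONE-STEP-MAP SCHEMAS.**  (G-T1) (`lam ≤ ℓ₁`), (G-T2-last) (`lam₂ ≤ ℓ₂`),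
(G-T2-old) with channels `0 ≤ a k j ≤ c·ω₁^{k−j}`, `0 ≤ b k j ≤ c_b·ω₁^{k−j}`, (Adm-run), a space table non-empty at every point, `0 < γ`, `ν > ω₁ + c` with `ν ≥ (ω₁ + c)²` ⟹ for the tower
`toClusterTower G`, in J45∕J48∕J49's box-history shape: **`‖E^{(k+1)}(X; g∣g_i:=t+d; φ) − 2E^{(k+1)}(X; g∣g_i:=t; φ) + E^{(k+1)}(X; g∣g_i:=t−d; φ)‖ ≤ L₂·ν^{k−i}·e^{−κd_{k+1}(X)}·d²`**,
`L₂ = max ℓ₂ (c_b ℓ₁²∕(ν − ω₁ − c))` — §1 into module J51's `termSecondDiffAt_box_of_termStepRecursion` (the re-twist; pub-balaban's ROAD 1 and dag-n22-a's second-order recursion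
by name).  NO smallness of `ω₁ + c`. [folklore] -/
theorem termSecondDiffAt_box_toClusterTower_of_genStepRecursion (hsp : ∀ k X, (sp k X).Nonempty) {γ κ ℓ₁ ℓ₂ c cb ω₁ ν : ℝ} {lam lam₂ : ℕ → ℝ} {a b : ℕ → ℕ → ℝ}
    (hγ : 0 < γ) (hAdm : ∀ g ∈ Window γ, ∀ k, Adm k (olderOf (recTerm G fun n => ((g n : ℝ) : ℂ)) k))
    (hG1 : ∀ (k : ℕ), ∀ t ∈ Ioc (0 : ℝ) γ, ∀ t' ∈ Ioc (0 : ℝ) γ, ∀ (old old' : OlderTerms P 𝔸 M k), Adm k old → Adm k old' → ∀ (D : ℕ → ℝ),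
      (∀ (k' : ℕ) (hk' : k' < k) (Y : (domSys P M (k' + 1)).Dom), ∀ φ' ∈ sp k' Y,
        ‖old ⟨k' + 1, Nat.succ_lt_succ hk'⟩ Y φ' - old' ⟨k' + 1, Nat.succ_lt_succ hk'⟩ Y φ'‖ ≤ Real.exp (-(κ * (domSys P M (k' + 1)).dj Y)) * D (k' + 1)) →
      ∀ (X : (domSys P M (k + 1)).Dom), ∀ φ ∈ sp k X,
        ‖(G k).E ((t : ℝ) : ℂ) old φ X - (G k).E ((t' : ℝ) : ℂ) old' φ X‖ ≤
          Real.exp (-(κ * (domSys P M (k + 1)).dj X)) * (lam k * |t - t'| + ∑ j ∈ range (k + 1), a k j * D j))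
    (hlam : ∀ k, lam k ≤ ℓ₁) (hℓ₁ : 0 ≤ ℓ₁)
    (hG2last : ∀ (k : ℕ) (old : OlderTerms P 𝔸 M k), Adm k old → ∀ (t d : ℝ), 0 < d → t - d ∈ Ioc (0 : ℝ) γ → t + d ∈ Ioc (0 : ℝ) γ →
      ∀ (X : (domSys P M (k + 1)).Dom), ∀ φ ∈ sp k X,
        ‖(G k).E ((t + d : ℝ) : ℂ) old φ X - 2 * (G k).E ((t : ℝ) : ℂ) old φ X + (G k).E ((t - d : ℝ) : ℂ) old φ X‖ ≤
          Real.exp (-(κ * (domSys P M (k + 1)).dj X)) * (lam₂ k * d ^ 2))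
    (hG2old : ∀ (k : ℕ), ∀ t ∈ Ioc (0 : ℝ) γ, ∀ (o₁ o₂ o₃ : OlderTerms P 𝔸 M k), Adm k o₁ → Adm k o₂ → Adm k o₃ → ∀ (D₁ D₂ : ℕ → ℝ),
      (∀ (k' : ℕ) (hk' : k' < k) (Y : (domSys P M (k' + 1)).Dom), ∀ φ' ∈ sp k' Y,
        ‖o₁ ⟨k' + 1, Nat.succ_lt_succ hk'⟩ Y φ' - o₂ ⟨k' + 1, Nat.succ_lt_succ hk'⟩ Y φ'‖ ≤ Real.exp (-(κ * (domSys P M (k' + 1)).dj Y)) * D₁ (k' + 1) ∧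
        ‖o₂ ⟨k' + 1, Nat.succ_lt_succ hk'⟩ Y φ' - o₃ ⟨k' + 1, Nat.succ_lt_succ hk'⟩ Y φ'‖ ≤ Real.exp (-(κ * (domSys P M (k' + 1)).dj Y)) * D₁ (k' + 1) ∧
        ‖o₁ ⟨k' + 1, Nat.succ_lt_succ hk'⟩ Y φ' - 2 * o₂ ⟨k' + 1, Nat.succ_lt_succ hk'⟩ Y φ' + o₃ ⟨k' + 1, Nat.succ_lt_succ hk'⟩ Y φ'‖ ≤
          Real.exp (-(κ * (domSys P M (k' + 1)).dj Y)) * D₂ (k' + 1)) →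
      ∀ (X : (domSys P M (k + 1)).Dom), ∀ φ ∈ sp k X,
        ‖(G k).E ((t : ℝ) : ℂ) o₁ φ X - 2 * (G k).E ((t : ℝ) : ℂ) o₂ φ X + (G k).E ((t : ℝ) : ℂ) o₃ φ X‖ ≤
          Real.exp (-(κ * (domSys P M (k + 1)).dj X)) * ∑ j ∈ range (k + 1), (a k j * D₂ j + b k j * D₁ j ^ 2))
    (ha : ∀ k j, j ≤ k → 0 ≤ a k j ∧ a k j ≤ c * ω₁ ^ (k - j)) (hb : ∀ k j, j ≤ k → 0 ≤ b k j ∧ b k j ≤ cb * ω₁ ^ (k - j))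
    (hlam₂ : ∀ k, lam₂ k ≤ ℓ₂) (hℓ₂ : 0 ≤ ℓ₂) (hc : 0 ≤ c) (hcb : 0 ≤ cb) (hω₁ : 0 ≤ ω₁) (hν : ω₁ + c < ν) (hμν : (ω₁ + c) ^ 2 ≤ ν) :
    ∀ (k : ℕ) (i : Fin (k + 1)), ∀ g ∈ box γ k, ∀ (X : (domSys P M (k + 1)).Dom), ∀ φ ∈ sp k X, ∀ t d : ℝ, 0 < d →
      t - d ∈ Ioc (0 : ℝ) γ → t + d ∈ Ioc (0 : ℝ) γ →
        ‖(toClusterTower G k).E (Function.update g i (t + d)) φ X - 2 * (toClusterTower G k).E (Function.update g i t) φ X +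
            (toClusterTower G k).E (Function.update g i (t - d)) φ X‖ ≤
          max ℓ₂ (cb * ℓ₁ ^ 2 / (ν - ω₁ - c)) * ν ^ (k - (i : ℕ)) * Real.exp (-(κ * (domSys P M (k + 1)).dj X)) * d ^ 2 :=
  termSecondDiffAt_box_of_termStepRecursion (toClusterTower G) sp hsp hγ (termT1_toClusterTower_of_gen G sp Adm hAdm hG1) hlam hℓ₁
    (termT2last_toClusterTower_of_gen G sp Adm hAdm hG2last) (termT2old_toClusterTower_of_gen G sp Adm hAdm hG2old) ha hb hlam₂ hℓ₂ hc hcb hω₁ hν hμν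

/-! ## §3 Run truncation: the letter passes to `truncRun K S` (no term after the run) -/

/-- ★ **A TERM-LEVEL SECOND-DIFFERENCE LETTER WITH A NON-NEGATIVE TABLE PASSES TO THE RUN TRUNCATIONS**: below the run length the step data agree (`truncRun_of_lt`); at and beyond it
the step is termless and its (2.13) term vanishes (`truncRun_of_le`, `E_termlessTower`), so the letter holds with room. [folklore] -/
theorem termSecondDiffAt_box_truncRun (S : ClusterTower P 𝔸 M) (K : ℕ) {γ κ : ℝ} {T : ℕ → ℕ → ℝ} (hT : ∀ k i, 0 ≤ T k i)
    (h : ∀ (k : ℕ) (i : Fin (k + 1)), ∀ g ∈ box γ k, ∀ (X : (domSys P M (k + 1)).Dom), ∀ φ ∈ sp k X, ∀ t d : ℝ, 0 < d →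
      t - d ∈ Ioc (0 : ℝ) γ → t + d ∈ Ioc (0 : ℝ) γ →
        ‖(S k).E (Function.update g i (t + d)) φ X - 2 * (S k).E (Function.update g i t) φ X + (S k).E (Function.update g i (t - d)) φ X‖ ≤
          T k i * Real.exp (-(κ * (domSys P M (k + 1)).dj X)) * d ^ 2) :
    ∀ (k : ℕ) (i : Fin (k + 1)), ∀ g ∈ box γ k, ∀ (X : (domSys P M (k + 1)).Dom), ∀ φ ∈ sp k X, ∀ t d : ℝ, 0 < d →
      t - d ∈ Ioc (0 : ℝ) γ → t + d ∈ Ioc (0 : ℝ) γ →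
        ‖(truncRun K S k).E (Function.update g i (t + d)) φ X - 2 * (truncRun K S k).E (Function.update g i t) φ X +
            (truncRun K S k).E (Function.update g i (t - d)) φ X‖ ≤
          T k i * Real.exp (-(κ * (domSys P M (k + 1)).dj X)) * d ^ 2 := by
  intro k i g hg X φ hφ t d hd hm hp
  by_cases hk : k < K
  · rw [truncRun_of_lt S hk]
    exact h k i g hg X φ hφ t d hd hm hp
  · rw [truncRun_of_le S (Nat.not_lt.mp hk), E_termlessTower, E_termlessTower, E_termlessTower]
    rw [mul_zero, sub_zero, zero_add, norm_zero]
    have := hT k i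
    positivity

open Finset in
/-- ★★ **THE LETTER FOR node00-def-W1's RUN TOWERS OF RECORD `truncRun K (toClusterTower G)`** (the run of `K` steps on torus `K` generated by `G`: def-W1's `runTowers`, module J44's
`S K := truncRun K (toClusterTower (Gn K))`): the generator schemas of §2 ⟹ the term-level second-difference letter with table `L₂·ν^{k−i}` for `truncRun K (toClusterTower G)`, every
run length `K` — §2 + `termSecondDiffAt_box_truncRun`.  Module J54 feeds it, torus by torus, to J49 §2 at the record. [folklore] -/
theorem termSecondDiffAt_box_truncRun_toClusterTower_of_genStepRecursion (hsp : ∀ k X, (sp k X).Nonempty) {γ κ ℓ₁ ℓ₂ c cb ω₁ ν : ℝ} {lam lam₂ : ℕ → ℝ}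
    {a b : ℕ → ℕ → ℝ} (hγ : 0 < γ) (hAdm : ∀ g ∈ Window γ, ∀ k, Adm k (olderOf (recTerm G fun n => ((g n : ℝ) : ℂ)) k))
    (hG1 : ∀ (k : ℕ), ∀ t ∈ Ioc (0 : ℝ) γ, ∀ t' ∈ Ioc (0 : ℝ) γ, ∀ (old old' : OlderTerms P 𝔸 M k), Adm k old → Adm k old' → ∀ (D : ℕ → ℝ),
      (∀ (k' : ℕ) (hk' : k' < k) (Y : (domSys P M (k' + 1)).Dom), ∀ φ' ∈ sp k' Y,
        ‖old ⟨k' + 1, Nat.succ_lt_succ hk'⟩ Y φ' - old' ⟨k' + 1, Nat.succ_lt_succ hk'⟩ Y φ'‖ ≤ Real.exp (-(κ * (domSys P M (k' + 1)).dj Y)) * D (k' + 1)) →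
      ∀ (X : (domSys P M (k + 1)).Dom), ∀ φ ∈ sp k X,
        ‖(G k).E ((t : ℝ) : ℂ) old φ X - (G k).E ((t' : ℝ) : ℂ) old' φ X‖ ≤
          Real.exp (-(κ * (domSys P M (k + 1)).dj X)) * (lam k * |t - t'| + ∑ j ∈ range (k + 1), a k j * D j))
    (hlam : ∀ k, lam k ≤ ℓ₁) (hℓ₁ : 0 ≤ ℓ₁)
    (hG2last : ∀ (k : ℕ) (old : OlderTerms P 𝔸 M k), Adm k old → ∀ (t d : ℝ), 0 < d → t - d ∈ Ioc (0 : ℝ) γ → t + d ∈ Ioc (0 : ℝ) γ →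
      ∀ (X : (domSys P M (k + 1)).Dom), ∀ φ ∈ sp k X,
        ‖(G k).E ((t + d : ℝ) : ℂ) old φ X - 2 * (G k).E ((t : ℝ) : ℂ) old φ X + (G k).E ((t - d : ℝ) : ℂ) old φ X‖ ≤
          Real.exp (-(κ * (domSys P M (k + 1)).dj X)) * (lam₂ k * d ^ 2))
    (hG2old : ∀ (k : ℕ), ∀ t ∈ Ioc (0 : ℝ) γ, ∀ (o₁ o₂ o₃ : OlderTerms P 𝔸 M k), Adm k o₁ → Adm k o₂ → Adm k o₃ → ∀ (D₁ D₂ : ℕ → ℝ),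
      (∀ (k' : ℕ) (hk' : k' < k) (Y : (domSys P M (k' + 1)).Dom), ∀ φ' ∈ sp k' Y,
        ‖o₁ ⟨k' + 1, Nat.succ_lt_succ hk'⟩ Y φ' - o₂ ⟨k' + 1, Nat.succ_lt_succ hk'⟩ Y φ'‖ ≤ Real.exp (-(κ * (domSys P M (k' + 1)).dj Y)) * D₁ (k' + 1) ∧
        ‖o₂ ⟨k' + 1, Nat.succ_lt_succ hk'⟩ Y φ' - o₃ ⟨k' + 1, Nat.succ_lt_succ hk'⟩ Y φ'‖ ≤ Real.exp (-(κ * (domSys P M (k' + 1)).dj Y)) * D₁ (k' + 1) ∧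
        ‖o₁ ⟨k' + 1, Nat.succ_lt_succ hk'⟩ Y φ' - 2 * o₂ ⟨k' + 1, Nat.succ_lt_succ hk'⟩ Y φ' + o₃ ⟨k' + 1, Nat.succ_lt_succ hk'⟩ Y φ'‖ ≤
          Real.exp (-(κ * (domSys P M (k' + 1)).dj Y)) * D₂ (k' + 1)) →
      ∀ (X : (domSys P M (k + 1)).Dom), ∀ φ ∈ sp k X,
        ‖(G k).E ((t : ℝ) : ℂ) o₁ φ X - 2 * (G k).E ((t : ℝ) : ℂ) o₂ φ X + (G k).E ((t : ℝ) : ℂ) o₃ φ X‖ ≤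
          Real.exp (-(κ * (domSys P M (k + 1)).dj X)) * ∑ j ∈ range (k + 1), (a k j * D₂ j + b k j * D₁ j ^ 2))
    (ha : ∀ k j, j ≤ k → 0 ≤ a k j ∧ a k j ≤ c * ω₁ ^ (k - j)) (hb : ∀ k j, j ≤ k → 0 ≤ b k j ∧ b k j ≤ cb * ω₁ ^ (k - j))
    (hlam₂ : ∀ k, lam₂ k ≤ ℓ₂) (hℓ₂ : 0 ≤ ℓ₂) (hc : 0 ≤ c) (hcb : 0 ≤ cb) (hω₁ : 0 ≤ ω₁) (hν : ω₁ + c < ν) (hμν : (ω₁ + c) ^ 2 ≤ ν) (K : ℕ) :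
    ∀ (k : ℕ) (i : Fin (k + 1)), ∀ g ∈ box γ k, ∀ (X : (domSys P M (k + 1)).Dom), ∀ φ ∈ sp k X, ∀ t d : ℝ, 0 < d →
      t - d ∈ Ioc (0 : ℝ) γ → t + d ∈ Ioc (0 : ℝ) γ →
        ‖(truncRun K (toClusterTower G) k).E (Function.update g i (t + d)) φ X - 2 * (truncRun K (toClusterTower G) k).E (Function.update g i t) φ X +
            (truncRun K (toClusterTower G) k).E (Function.update g i (t - d)) φ X‖ ≤
          max ℓ₂ (cb * ℓ₁ ^ 2 / (ν - ω₁ - c)) * ν ^ (k - (i : ℕ)) * Real.exp (-(κ * (domSys P M (k + 1)).dj X)) * d ^ 2 := by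
  have hL₂ : 0 ≤ max ℓ₂ (cb * ℓ₁ ^ 2 / (ν - ω₁ - c)) := hℓ₂.trans (le_max_left _ _)
  have hν0 : 0 ≤ ν := le_trans (sq_nonneg _) hμν
  exact termSecondDiffAt_box_truncRun sp (toClusterTower G) K (T := fun k i => max ℓ₂ (cb * ℓ₁ ^ 2 / (ν - ω₁ - c)) * ν ^ (k - i))
    (fun k i => mul_nonneg hL₂ (pow_nonneg hν0 _))
    (termSecondDiffAt_box_toClusterTower_of_genStepRecursion G sp Adm hsp hγ hAdm hG1 hlam hℓ₁ hG2last hG2old ha hb hlam₂ hℓ₂ hc hcb hω₁ hν hμν)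

end YMDAG.N22.TermRecursion

end
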